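import Literature.NumberTheory.DiophantineGeometry.GenEllBDClasses
import Literature.NumberTheory.DiophantineGeometry.FaltingsHeightJInvariant
import Literature.IUT.LogVolume.ArakelovDivisors
import Mathlib.FieldTheory.IntermediateField.Adjoin.Basic
import HarnessLib

/-!
# [GenEll] §3 for the moduli of elliptic curves: `deg_∞`, `ht_∞`, `ht^Falt`, local heights, Prop. 3.4

S. Mochizuki, *Arithmetic elliptic curves in general position*, Math. J. Okayama Univ. 52 (2010)
[cite: MochizukiGenEll2010] (kurims manuscript, Feb. 2009), §3 pp. 14–17, read on the page:

> (p. 15) Def. 3.3: "We shall refer to the positive integer `v_K(q_E) ∈ ℤ_{>0}` as the local height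
> of `E` [or `E_K`]" (for `E → Spec 𝓞_K` semi-abelian with `E_k ≅ 𝔾_m`, `q_E` its Tate parameter);
> Rmk. 3.3.1 (p. 16): for potentially multiplicative reduction divide the local height over a field
> of multiplicative reduction by the ramification index.
> (p. 16) `ht^Falt(E) := deg_F(ω̄_E)` (the Faltings height); `deg_∞(E) := deg_F(∞_E)`,
> `∞_E := φ^{-1}(∞_M)` for the classifying morphism `φ : Spec(𝓞_F) → M̄_ell`; `ht_∞` "the
> BD-class of height functions determined by the line bundle `𝒪_{M̄_ell}(∞_M)`"; all three regarded
> as functions on `M_ell(Q̄)`.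
> (p. 17) **Proposition 3.4. (Faltings Heights and the Divisor at Infinity)** For any `ε ∈ ℝ_{>0}`,
> we have `deg_∞ ≲ ht_∞ ≲ 12(1 + ε)·ht^Falt ≲ (1 + ε)·ht_∞` on `M_ell(Q̄)`. In particular, if
> `C ∈ ℝ`, then the set of points `[E] ∈ M_ell(Q̄)^{≤d}` such that `ht^Falt([E]) ≤ C` is finite.
> *Proof.* The first "`≲`" follows immediately from the definitions […]. The remaining "`≲`'s"
> follows from [Silv2], Proposition 2.1 […]. Finally, the finiteness assertion follows […], together
> with Proposition 1.4, (iv).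

## Rendering over the tree (`FaltingsHeight.lean`, `FaltingsHeightJInvariant.lean`)

A point `[E] ∈ M_ell(Q̄)` is PRESENTED (as for `NFPoint` in `GenEllProjLine.lean`) by a number field
`F` and an elliptic Weierstrass model `W` over `F` (`EllPoint`). Since `E → Spec 𝓞_F` in [GenEll] §3
is semi-abelian (semistable reduction), the divisor of `q`-parameters `∞_E` is the denominator ideal
`𝔇` of `j(E)` (Silverman 1986 §2: `(j) = 𝔄𝔇⁻¹`, `𝔇 = Δ_{E/K}` for semistable `E`), and `v(q_E) =
−v(j_E)` at multiplicative primes; we therefore take the STABLE (base-change invariant) renderings: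

* `degInf P := [F:ℚ]⁻¹ · log N(𝔇)`, `𝔇 = W.jDenominatorIdeal` — `deg_∞`;
* `htInf P := [F:ℚ]⁻¹ · h_F(j(E))` (normalised Weil height of `j`) — representative of the BD-class
  `ht_∞` (`𝒪(∞_M)` pulls back to `𝒪(1)` on the `j`-line);
* `htFalt P := W.stableFaltingsHeight` — `ht^Falt` (= Faltings' `deg ω̄_E` for a semistable model);
* `localHeight P v := −ord_v(j(E))` (an integer, positive exactly at the primes of potentially
  multiplicative reduction) — Def. 3.3 / Rmk. 3.3.1 through `v(q_E) = −v(j_E)`;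
* `prop34Ineq ε` / `prop34Finite` — the two sentences of Prop. 3.4 as predicates; the second and
  third "`≲`" are DERIVED from the tree's named fact `silverman1986_jHeight_faltingsHeight`
  (Silverman 1986 Prop. 2.1, exactly the paper's citation [Silv2]) in `prop34_mid_of_silverman`,
  `prop34_right_of_silverman`.

Deliberately NOT here: Lemma 3.1 (pure group theory of `SL₂(𝔽_l)`), Lemma 3.2 and the mod-`l` Tate
module, Lemmas 3.5–3.7, Thm. 3.8 and §4 (separate files, over the tree's `galoisRepTorsion`).
-/

noncomputable section

open NumberField IsDedekindDomain

namespace Literature.NumberTheory.DiophantineGeometry.GenEll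

/-- A point `[E]` of `M_ell(Q̄)` PRESENTED over a number field: `F` and an elliptic Weierstrass
model `W` over `F` (the point is the isomorphism class of `E_W ×_F Q̄`, i.e. `j(W) ∈ Q̄`).
[cite: MochizukiGenEll2010, §3 p.16] -/
structure EllPoint : Type 1 where
  /-- the number field over which the curve is presented -/
  F : Type
  [instField : Field F]
  [instNumberField : NumberField F]
  /-- a Weierstrass model of the curve -/
  W : WeierstrassCurve F
  [instElliptic : W.IsElliptic]

/-- Field structure of the presenting field (bundled projection; overrides nothing).
[cite: MochizukiGenEll2010, §3 p.16] -/
instance EllPoint.field (P : EllPoint) : Field P.F := P.instField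

/-- Number-field structure of the presenting field (bundled projection; overrides nothing).
[cite: MochizukiGenEll2010, §3 p.16] -/
instance EllPoint.numberField (P : EllPoint) : NumberField P.F := P.instNumberField

/-- The presented model is elliptic (bundled projection; overrides nothing).
[cite: MochizukiGenEll2010, §3 p.16] -/
instance EllPoint.isElliptic (P : EllPoint) : P.W.IsElliptic := P.instElliptic

namespace EllPoint

/-- The degree `[F:ℚ]` of the presenting field. [cite: MochizukiGenEll2010, Ex 1.3 (i) p.5] -/
def degree (P : EllPoint) : ℕ := Module.finrank ℚ P.F

/-- The degree is positive. [cite: MochizukiGenEll2010, Ex 1.3 (i) p.5] -/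
theorem degree_pos (P : EllPoint) : 0 < P.degree := Module.finrank_pos

/-- `F` is a minimal field of definition of the point `[E] ∈ M_ell(Q̄)`: `ℚ(j(E)) = F` (the point of
the moduli space is its `j`-invariant; [GenEll] Def. 1.5 (i) for `X = M̄_ell`).
[cite: MochizukiGenEll2010, Def 1.5 (i) p.8] -/
def IsMinimal (P : EllPoint) : Prop := IntermediateField.adjoin ℚ ({P.W.j} : Set P.F) = ⊤

/-- `deg_∞([E]) := deg_F(∞_E)`, the normalised degree of the pull-back of the divisor at infinity of
`M̄_ell`, rendered stably as `[F:ℚ]⁻¹ · log N(𝔇)` with `𝔇` the denominator ideal of `j(E)` (for the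
semi-abelian `E → Spec 𝓞_F` of [GenEll] §3, `∞_E = 𝔇 = Δ_{E/F}`). [cite: MochizukiGenEll2010, §3 p.16] -/
def degInf (P : EllPoint) : ℝ :=
  (P.degree : ℝ)⁻¹ * Real.log (Ideal.absNorm P.W.jDenominatorIdeal)

/-- `ht_∞([E])` — representative of "the BD-class of height functions determined by the line bundle
`𝒪_{M̄_ell}(∞_M)`": the normalised Weil height `[F:ℚ]⁻¹ · h_F(j(E))` of the `j`-invariant
(`𝒪(∞_M)` is `𝒪(1)` on the `j`-line; [GenEll] Prop. 1.4 (iii)). [cite: MochizukiGenEll2010, §3 p.16] -/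
def htInf (P : EllPoint) : ℝ := (P.degree : ℝ)⁻¹ * Height.logHeight₁ P.W.j

/-- `ht^Falt([E]) := deg_F(ω̄_E)`, the Faltings height of (a semi-abelian model of) `E`, i.e. the
stable Faltings height; the tree's `WeierstrassCurve.stableFaltingsHeight` (Faltings' original
normalisation, `FaltingsHeight.lean`). [cite: MochizukiGenEll2010, §3 p.16] -/
def htFalt (P : EllPoint) : ℝ := P.W.stableFaltingsHeight

/-- The **local height** of `E` at a finite prime `v` ([GenEll] Def. 3.3: `v_K(q_E) ∈ ℤ_{>0}` for
multiplicative reduction; Rmk. 3.3.1: for potentially multiplicative reduction, the local height over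
a field of multiplicative reduction divided by the ramification index), rendered through the Tate
parameter's valuation `v(q_E) = −v(j(E))`: `localHeight v := −ord_v(j(E))` (`ord_v` the normalised
valuation of `Literature.IUT.LogVolume.ArakelovDivisors`). It is `> 0` exactly at the primes of
potentially multiplicative reduction (`ord_v(j) < 0`) and `≤ 0` elsewhere (where the paper assigns no
local height). [cite: MochizukiGenEll2010, Def 3.3 p.15] -/
def localHeight (P : EllPoint) (v : HeightOneSpectrum (𝓞 P.F)) : ℤ :=
  -Literature.IUT.LogVolume.ord P.F v P.W.j

/-- `E` has potentially multiplicative reduction at `v`: `ord_v(j(E)) < 0`, i.e. the local height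
is positive. [cite: MochizukiGenEll2010, Rmk 3.3.1 p.16] -/
def IsPotMult (P : EllPoint) (v : HeightOneSpectrum (𝓞 P.F)) : Prop := 0 < P.localHeight v

end EllPoint

/-- `M_ell(Q̄)^{≤ d}`: points presented over a field of degree `≤ d` (a point definable over a field
of degree `≤ d` has such a presentation). [cite: MochizukiGenEll2010, Ex 1.3 (i) p.5] -/
def MellLe (d : ℕ) : Set EllPoint := {P | P.degree ≤ d}

/-- "Finitely many points of `M_ell(Q̄)`" for a set of presented points, counted through the minimal
polynomial of the `j`-invariant (a Q̄-point of `M_ell` and its conjugates share one; cf.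
`HasFinitelyManyPoints` in `GenEllNorthcott.lean`). [cite: MochizukiGenEll2010, Ex 1.3 (i) p.5] -/
def MellHasFinitelyManyPoints (S : Set EllPoint) : Prop :=
  ((fun P : EllPoint => minpoly ℚ P.W.j) '' S).Finite

/-- **[GenEll] Prop. 3.4, displayed inequalities**, for a given `ε > 0`:
`deg_∞ ≲ ht_∞ ≲ 12(1+ε)·ht^Falt ≲ (1+ε)·ht_∞` on `M_ell(Q̄)` (three `≲` of functions on the set of
all presented points). A predicate; see `prop34_mid_of_silverman`, `prop34_right_of_silverman` for
the parts derived from Silverman 1986 Prop. 2.1. [cite: MochizukiGenEll2010, Prop 3.4 p.17] -/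
def prop34Ineq (ε : ℝ) : Prop :=
  BDLe Set.univ EllPoint.degInf EllPoint.htInf ∧
    BDLe Set.univ EllPoint.htInf (fun P => 12 * (1 + ε) * P.htFalt) ∧
      BDLe Set.univ (fun P : EllPoint => 12 * (1 + ε) * P.htFalt) (fun P => (1 + ε) * P.htInf)

/-- **[GenEll] Prop. 3.4, finiteness clause**: for every positive integer `d` and `C ∈ ℝ`, the points
`[E] ∈ M_ell(Q̄)^{≤d}` with `ht^Falt([E]) ≤ C` are finitely many (finitely many `j`-invariants up to
conjugacy). A predicate (it follows from the inequalities and [GenEll] Prop. 1.4 (iv) = Northcott).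
[cite: MochizukiGenEll2010, Prop 3.4 p.17] -/
def prop34Finite : Prop :=
  ∀ (d : ℕ) (C : ℝ), MellHasFinitelyManyPoints {P | P ∈ MellLe d ∧ P.htFalt ≤ C}

/-! ## The parts of Prop. 3.4 that follow from Silverman 1986, Prop. 2.1 -/

/-- An elementary bound: for `A ≥ 0`, `δ > 0` and `h ≥ 0`, `A·log(1 + h) ≤ δ·h + (A·log(A/δ + 1) + δ)`
(concavity of `log`: `log y ≤ y/t + log t − 1`). [folklore] -/
private theorem log_growth_bound {A δ h : ℝ} (hA : 0 ≤ A) (hδ : 0 < δ) (hh : 0 ≤ h) :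
    A * Real.log (1 + h) ≤ δ * h + (A * Real.log (A / δ + 1) + δ) := by
  rcases eq_or_lt_of_le hA with rfl | hA'
  · simp only [zero_mul, zero_div, zero_add, Real.log_one, mul_zero]
    positivity
  -- `log(1+h) - log t ≤ (1+h)/t - 1` with `t = A/δ`
  set t : ℝ := A / δ with ht
  have ht0 : 0 < t := div_pos hA' hδ
  have h1h : 0 < 1 + h := by linarith
  have key : Real.log ((1 + h) / t) ≤ (1 + h) / t - 1 := Real.log_le_sub_one_of_pos (div_pos h1h ht0)
  rw [Real.log_div h1h.ne' ht0.ne'] at key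
  have hAt : A / t = δ := by rw [ht]; field_simp
  have : A * Real.log (1 + h) ≤ A * ((1 + h) / t - 1 + Real.log t) := by
    apply mul_le_mul_of_nonneg_left _ hA; linarith
  have h2 : A * ((1 + h) / t - 1 + Real.log t) = δ * h + δ - A + A * Real.log t := by
    rw [show A * ((1 + h) / t - 1 + Real.log t) = (A / t) * (1 + h) - A + A * Real.log t by ring, hAt]
    ring
  have h3 : Real.log t ≤ Real.log (A / δ + 1) := Real.log_le_log ht0 (by rw [ht]; linarith)
  nlinarith [mul_le_mul_of_nonneg_left h3 hA]

/-- **Prop. 3.4, middle inequality from Silverman 1986 Prop. 2.1**: `ht_∞ ≲ 12(1+ε)·ht^Falt` on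
`M_ell(Q̄)` for every `ε > 0` — from `h(j_E) ≤ 12 h_F(E) + 6 log(1 + h(j_E)) + C₂`
(`silverman1986_jHeight_faltingsHeight.stableFaltingsHeight_form`) and `6 log(1+h) ≤ (ε/(1+ε))·h + O_ε(1)`.
PROVED modulo the tree's named fact `silverman1986_jHeight_faltingsHeight` ([Silv2] = the paper's
own citation), taken as a hypothesis. [cite: MochizukiGenEll2010, Prop 3.4 p.17] -/
theorem prop34_mid_of_silverman (hS : silverman1986_jHeight_faltingsHeight) {ε : ℝ} (hε : 0 < ε) :
    BDLe Set.univ EllPoint.htInf (fun P => 12 * (1 + ε) * P.htFalt) := by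
  obtain ⟨C₁, C₂, hC⟩ := hS.stableFaltingsHeight_form
  -- constant: from `6(1+ε) log(1+h) ≤ ε h + K`
  set K : ℝ := 6 * (1 + ε) * Real.log (6 * (1 + ε) / ε + 1) + ε with hK
  refine ⟨(1 + ε) * C₂ + K, fun P _ => ?_⟩
  have h2 := (hC P.F P.W).2
  -- `h := htInf P ≥ 0`
  have hh : 0 ≤ P.htInf := by
    unfold EllPoint.htInf
    refine mul_nonneg (inv_nonneg.mpr (Nat.cast_nonneg _)) ?_
    rw [Height.logHeight₁_eq_log_mulHeight₁]
    exact Real.log_nonneg (Height.one_le_mulHeight₁ _)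
  have hlog := log_growth_bound (A := 6 * (1 + ε)) (δ := ε) (by positivity) hε hh
  change P.htInf - 12 * (1 + ε) * P.htFalt ≤ (1 + ε) * C₂ + K
  have h2' : P.htInf - 12 * P.htFalt ≤ 6 * Real.log (1 + P.htInf) + C₂ := h2
  have hε1 : 0 ≤ 1 + ε := by linarith
  have h3 : (1 + ε) * (P.htInf - 12 * P.htFalt) ≤ (1 + ε) * (6 * Real.log (1 + P.htInf) + C₂) :=
    mul_le_mul_of_nonneg_left h2' hε1
  rw [hK]
  nlinarith [h3, hlog]

/-- **Prop. 3.4, last inequality from Silverman 1986 Prop. 2.1**: `12(1+ε)·ht^Falt ≲ (1+ε)·ht_∞` on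
`M_ell(Q̄)` — from `C₁ ≤ h(j_E) − 12 h_F(E)`. PROVED modulo the tree's named fact
`silverman1986_jHeight_faltingsHeight`, taken as a hypothesis. [cite: MochizukiGenEll2010, Prop 3.4 p.17] -/
theorem prop34_right_of_silverman (hS : silverman1986_jHeight_faltingsHeight) {ε : ℝ} (hε : 0 < ε) :
    BDLe Set.univ (fun P : EllPoint => 12 * (1 + ε) * P.htFalt) (fun P => (1 + ε) * P.htInf) := by
  obtain ⟨C₁, C₂, hC⟩ := hS.stableFaltingsHeight_form
  refine ⟨-(1 + ε) * C₁, fun P _ => ?_⟩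
  have h1 : C₁ ≤ P.htInf - 12 * P.htFalt := (hC P.F P.W).1
  change 12 * (1 + ε) * P.htFalt - (1 + ε) * P.htInf ≤ -(1 + ε) * C₁
  have hε1 : 0 ≤ 1 + ε := by linarith
  nlinarith [mul_le_mul_of_nonneg_left h1 hε1]

end Literature.NumberTheory.DiophantineGeometry.GenEll

end
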